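import Mathlib
import Literature.AlgebraicGeometry.Resolution.CompletedChainCurveStep
import HarnessLib

/-!
# Tools for the descent down the completed chain (`τ = 1` endgame, OPTION R, brick R-5)

Topic: `Literature/AlgebraicGeometry/Resolution`. V. Cossart, U. Jannsen, S. Saito, LNM 2270 (2020), proof of
Thm. 13.7 and Claim 13.8 [cite: CossartJannsenSaito2020, Thm. 13.7]; V. Cossart, O. Piltant, J. Algebra 320
(2008), proof of Prop. 4.4 p. 11 [cite: CossartPiltant2008, Prop. 4.4]; H. Matsumura, *Commutative Ring
Theory*, §8 [cite: Matsumura1987, Thm. 8.11].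

OURS (small tools of the completed-chain descent `CompletedChainDescent`, no facts, no definitions):

* `exists_adapted_label_of_completion` — an ALGEBRAIC adapted label `(l, p₁, p₂)` of `R` under a formal
  adapted label `(ŷ, ι p₁, ι p₂)` of `R̂` (density `ŷ ≡ ι l mod 𝔪̂²`, faithful flatness, the initial forms
  of `R` and `R̂` agree: B0 `mem_initialForms_map_adicCompletion_iff`);
* `exists_span_pair_eq_of_adapted` — RE-PRESENTATION OF A PERMISSIBLE CENTRE through an adapted label:
  `(l, u, w)` adapted to `J` (`J ⊆ 𝔪^μ`, `J ⊄ 𝔪^{μ+1}`, `μ ≥ 1`), `y₁ ∈ 𝔪`, `J ⊆ (y₁, u)^μ` ⇒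
  `(y₁, u) = (l + r w, u)` (the `l`-coefficient of `y₁` is a unit; otherwise `(y₁, u) ⊆ F^{(1,2,2)}_2`,
  so `J ⊆ F_{2μ} ⊆ F_{μ+1}`, while a monic `g ≡ f l^μ` has `(1,2,2)`-order exactly `μ`);
* bookkeeping with associates: colon ideals by powers of associates, spans with an associate generator.

F-71 / T1 NOT proved; no summit statement is proved. AI-written; weaker than expert review.
-/

noncomputable section

open IsLocalRing MvPolynomial

namespace Literature.AlgebraicGeometry.Resolution

universe u

/-! ## Associates: spans and colon ideals -/

section Assoc

variable {S : Type u} [CommRing S]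

/-- `(y, v) = (y, u)` when `(v) = (u)` (associates generate the same ideals). [cite: Matsumura1987, §1 (p. 2)] -/
theorem span_pair_eq_of_span_singleton_eq (y : S) {v u : S} (h : Ideal.span ({v} : Set S) = Ideal.span {u}) :
    Ideal.span ({y, v} : Set S) = Ideal.span {y, u} := by
  rw [Ideal.span_insert, h, ← Ideal.span_insert]

/-- `(v, y) = (u, y)` when `(v) = (u)`. [cite: Matsumura1987, §1 (p. 2)] -/
theorem span_pair_eq_of_span_singleton_eq' (y : S) {v u : S} (h : Ideal.span ({v} : Set S) = Ideal.span {u}) :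
    Ideal.span ({v, y} : Set S) = Ideal.span {u, y} := by
  rw [Ideal.span_pair_comm, span_pair_eq_of_span_singleton_eq y h, Ideal.span_pair_comm]

/-- `(y, v, w) = (y, u, w)` when `(v) = (u)`. [cite: Matsumura1987, §1 (p. 2)] -/
theorem span_triple_eq_of_span_singleton_eq (y w : S) {v u : S}
    (h : Ideal.span ({v} : Set S) = Ideal.span {u}) :
    Ideal.span ({y, v, w} : Set S) = Ideal.span {y, u, w} := by
  rw [Ideal.span_insert, Ideal.span_insert, h, ← Ideal.span_insert, ← Ideal.span_insert]

/-- Colon ideals by powers of associate elements agree: `(N : a^μ) = (N : b^μ)` when `(a) = (b)`. [cite: Matsumura1987, §1 (p. 2)] -/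
theorem colon_singleton_pow_eq_of_span_singleton_eq (N : Ideal S) {a b : S}
    (h : Ideal.span ({a} : Set S) = Ideal.span {b}) (μ : ℕ) : N.colon {a ^ μ} = N.colon {b ^ μ} := by
  have hab : a ∈ Ideal.span ({b} : Set S) := h ▸ Ideal.mem_span_singleton_self a
  have hba : b ∈ Ideal.span ({a} : Set S) := h.symm ▸ Ideal.mem_span_singleton_self b
  obtain ⟨s, hs⟩ := Ideal.mem_span_singleton'.mp hab
  obtain ⟨t, ht⟩ := Ideal.mem_span_singleton'.mp hba
  ext r
  simp only [Submodule.mem_colon_singleton, smul_eq_mul]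
  constructor
  · intro hr
    have : r * b ^ μ = t ^ μ * (r * a ^ μ) := by rw [← ht]; ring
    rw [this]; exact N.mul_mem_left _ hr
  · intro hr
    have : r * a ^ μ = s ^ μ * (r * b ^ μ) := by rw [← hs]; ring
    rw [this]; exact N.mul_mem_left _ hr

/-- The image of a principal ideal: `(a) T = (φ a)`. [cite: Matsumura1987, §1 (p. 2)] -/
theorem map_span_singleton' {T : Type u} [CommRing T] (φ : S →+* T) (a : S) :
    (Ideal.span ({a} : Set S)).map φ = Ideal.span {φ a} := by
  rw [Ideal.map_span, Set.image_singleton]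

end Assoc

/-! ## An algebraic adapted label under a formal one -/

section Algebraic

variable {R : Type u} [CommRing R] [IsRegularLocalRing R] (hdim : ringKrullDim R = 3)
  {I : Ideal R} {μ : ℕ}

include hdim in
/-- **An algebraic adapted label under a formal adapted label.** If `x = (ŷ, ι p₁, ι p₂)` is a regular system of
parameters of `R̂` adapted to `I R̂` (`L < δs`, `I ⊆ 𝔪^μ`), then for an `𝔪̂`-adic approximation `l ∈ R` of
`ŷ` to order `2`, `(l, p₁, p₂)` is a regular system of parameters of `R` adapted to `I`.
[cite: Matsumura1987, Thm. 8.11] [cite: CossartJannsenSaito2020, Thm. 13.7 (proof)] -/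
theorem exists_adapted_label_of_completion (hIμ : I ≤ maximalIdeal R ^ μ)
    [IsRegularLocalRing (AdicCompletion (maximalIdeal R) R)]
    (x : Fin 3 → AdicCompletion (maximalIdeal R) R) (p₁ p₂ : R)
    (hx1 : x 1 = algebraMap R (AdicCompletion (maximalIdeal R) R) p₁)
    (hx2 : x 2 = algebraMap R (AdicCompletion (maximalIdeal R) R) p₂)
    (hgenx : Ideal.span {x 0, x 1, x 2} = maximalIdeal (AdicCompletion (maximalIdeal R) R))
    (hδ : μ.factorial < deltaS x (I.map (algebraMap R (AdicCompletion (maximalIdeal R) R))) μ) :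
    ∃ l : R, algebraMap R (AdicCompletion (maximalIdeal R) R) l - x 0 ∈
        maximalIdeal (AdicCompletion (maximalIdeal R) R) ^ 2 ∧
      Ideal.span {l, p₁, p₂} = maximalIdeal R ∧
      ∀ G ∈ initialForms ![l, p₁, p₂] I μ, ∃ a : ResidueField R, G = C a * X 0 ^ μ := by
  classical
  have hdimA : ringKrullDim (AdicCompletion (maximalIdeal R) R) = 3 := by rw [ringKrullDim_adicCompletion, hdim]
  have hfrA : (maximalIdeal (AdicCompletion (maximalIdeal R) R)).spanFinrank = 3 := by
    have h := IsRegularLocalRing.spanFinrank_maximalIdeal (R := (AdicCompletion (maximalIdeal R) R))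
    rw [hdimA] at h
    exact_mod_cast h
  have hmA : maximalIdeal (AdicCompletion (maximalIdeal R) R) =
      (maximalIdeal R).map (algebraMap R (AdicCompletion (maximalIdeal R) R)) := AdicCompletion.maximalIdeal_eq_map
  have hIμA : I.map (algebraMap R (AdicCompletion (maximalIdeal R) R)) ≤
      maximalIdeal (AdicCompletion (maximalIdeal R) R) ^ μ := map_le_pow_maximalIdeal_adicCompletion hIμ
  have hgenxr := span_range_eq_of_span_triple x hgenx
  obtain ⟨l, hl⟩ := exists_sub_algebraMap_mem_pow_adicCompletion (x 0) 2
  set cR : Fin 3 → R := ![l, p₁, p₂] with hcR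
  have hdiff : ∀ i, (algebraMap R (AdicCompletion (maximalIdeal R) R)) (cR i) - x i ∈
      maximalIdeal (AdicCompletion (maximalIdeal R) R) ^ 2 := by
    intro i
    fin_cases i
    · show (algebraMap R (AdicCompletion (maximalIdeal R) R)) l - x 0 ∈ _
      rw [← neg_sub, Ideal.neg_mem_iff]; exact hl
    · show (algebraMap R (AdicCompletion (maximalIdeal R) R)) p₁ - x 1 ∈ _
      rw [hx1, sub_self]; exact Ideal.zero_mem _
    · show (algebraMap R (AdicCompletion (maximalIdeal R) R)) p₂ - x 2 ∈ _
      rw [hx2, sub_self]; exact Ideal.zero_mem _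
  have hgenιr : Ideal.span (Set.range (fun i => (algebraMap R (AdicCompletion (maximalIdeal R) R)) (cR i))) =
      maximalIdeal (AdicCompletion (maximalIdeal R) R) :=
    span_range_eq_of_sub_mem_sq hgenxr hdiff
  have hgenι : Ideal.span {(algebraMap R (AdicCompletion (maximalIdeal R) R)) (cR 0),
      (algebraMap R (AdicCompletion (maximalIdeal R) R)) (cR 1),
      (algebraMap R (AdicCompletion (maximalIdeal R) R)) (cR 2)} = maximalIdeal (AdicCompletion (maximalIdeal R) R) := by
    rw [← hgenιr]; congr 1; ext z
    simp only [Set.mem_insert_iff, Set.mem_singleton_iff, Set.mem_range]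
    constructor
    · rintro (rfl | rfl | rfl)
      exacts [⟨0, rfl⟩, ⟨1, rfl⟩, ⟨2, rfl⟩]
    · rintro ⟨i, rfl⟩; fin_cases i <;> simp
  -- the label generates `𝔪` (faithful flatness of `R → R̂`)
  haveI : Module.FaithfullyFlat R (AdicCompletion (maximalIdeal R) R) := Module.FaithfullyFlat.of_flat_of_isLocalHom
  have hgenR : Ideal.span {cR 0, cR 1, cR 2} = maximalIdeal R := by
    have h1 : (Ideal.span ({cR 0, cR 1, cR 2} : Set R)).map (algebraMap R (AdicCompletion (maximalIdeal R) R)) =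
        (maximalIdeal R).map (algebraMap R (AdicCompletion (maximalIdeal R) R)) := by
      rw [Ideal.map_span, Set.image_insert_eq, Set.image_insert_eq, Set.image_singleton, hgenι, hmA]
    have h2 := congrArg (Ideal.comap (algebraMap R (AdicCompletion (maximalIdeal R) R))) h1
    rwa [Ideal.comap_map_eq_self_of_faithfullyFlat, Ideal.comap_map_eq_self_of_faithfullyFlat] at h2
  -- the label is adapted: `cl_μ` of `x` = `cl_μ` of `ι ∘ cR` (same modulo `𝔪̂²`), then descend
  have hadx := forall_initialForms_of_lt_deltaS x hgenx hdimA hIμA hδ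
  have hformsι : ∀ G ∈ initialForms (fun i => (algebraMap R (AdicCompletion (maximalIdeal R) R)) (cR i))
      (I.map (algebraMap R (AdicCompletion (maximalIdeal R) R))) μ,
      ∃ a : ResidueField (AdicCompletion (maximalIdeal R) R), G = C a * X 0 ^ μ := by
    intro G hG
    rw [initialForms_eq_of_sub_mem_sq hfrA hgenxr hdiff] at hG
    exact hadx G hG
  have hadR : ∀ G ∈ initialForms cR I μ, ∃ a : ResidueField R, G = C a * X 0 ^ μ := by
    intro G hG
    have hbij := AdicCompletion.residueField_map_bijective R
    have hmem : MvPolynomial.map (ResidueField.map (algebraMap R (AdicCompletion (maximalIdeal R) R))) G ∈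
        initialForms (fun i => (algebraMap R (AdicCompletion (maximalIdeal R) R)) (cR i))
          (I.map (algebraMap R (AdicCompletion (maximalIdeal R) R))) μ :=
      (mem_initialForms_map_adicCompletion_iff cR hgenR hdim hIμ _).mpr ⟨G, hG, rfl⟩
    obtain ⟨a, ha⟩ := hformsι _ hmem
    obtain ⟨a₀, rfl⟩ := hbij.2 a
    refine ⟨a₀, MvPolynomial.map_injective _ hbij.1 ?_⟩
    rw [ha, map_mul, map_C, map_pow, map_X]
  exact ⟨l, hdiff 0, hgenR, hadR⟩

end Algebraic

/-! ## Re-presentation of a permissible centre through an adapted label -/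

section Centre

variable {S : Type u} [CommRing S] [IsRegularLocalRing S] (c : Fin 3 → S)
  (hgen : Ideal.span {c 0, c 1, c 2} = maximalIdeal S) (hdim : ringKrullDim S = 3)
  {J : Ideal S} {μ : ℕ}

omit [IsRegularLocalRing S] in
/-- Powers of a weighted order ideal: `F_ρ^k ⊆ F_{kρ}`. [cite: CossartJannsenSaito2020, Lemma 8.3 (1)] -/
theorem pow_weightedIdealW_le (w : Fin 3 → ℕ) (ρ : ℕ) :
    ∀ k : ℕ, weightedIdealW c w ρ ^ k ≤ weightedIdealW c w (k * ρ)
  | 0 => by rw [pow_zero, zero_mul, weightedIdealW_zero, Ideal.one_eq_top]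
  | k + 1 => by
    rw [pow_succ, add_mul, one_mul]
    exact (Ideal.mul_mono_left (pow_weightedIdealW_le w ρ k)).trans (weightedIdealW_mul_le c w _ _)

include hgen hdim in
/-- **Re-presentation of a permissible centre through an adapted label (OURS).** Let `c = (l, u, w)` be a
regular system of parameters adapted to `J` (`cl_μ(J) ⊆ k·L^μ`, `J ⊆ 𝔪^μ`, `J ⊄ 𝔪^{μ+1}`, `μ ≥ 1`),
`y₁ ∈ 𝔪` with `J ⊆ (y₁, u)^μ`. Then `(y₁, u) = (l + r w, u)` for some `r`: writing `y₁ = a l + b u + d w`,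
`a` is a unit — otherwise `y₁, u ∈ F^{(1,2,2)}_2`, so `J ⊆ F_{2μ} ⊆ F_{μ+1}`, whereas a monic `g ∈ J`,
`g ≡ f l^μ mod 𝔪^{μ+1}`, has `f l^μ ∉ F^{(1,2,2)}_{μ+1}` (weighted quasi-regularity).
[cite: CossartJannsenSaito2020, Claim 13.8] [cite: CossartPiltant2008, Prop. 4.4 (proof, p. 11)] -/
theorem exists_span_pair_eq_of_adapted (hμ : 1 ≤ μ) (hJμ : J ≤ maximalIdeal S ^ μ)
    (hJne : ¬ J ≤ maximalIdeal S ^ (μ + 1))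
    (had : ∀ G ∈ initialForms c J μ, ∃ a : ResidueField S, G = C a * X 0 ^ μ)
    (y₁ : S) (hy₁ : y₁ ∈ maximalIdeal S) (hJP : J ≤ Ideal.span {y₁, c 1} ^ μ) :
    ∃ r : S, Ideal.span ({y₁, c 1} : Set S) = Ideal.span {c 0 + r * c 2, c 1} := by
  classical
  have hgenr := span_range_eq_of_span_triple c hgen
  -- `y₁ = a l + b u + d w`
  rw [← hgen] at hy₁
  obtain ⟨a, z, hz, hy⟩ := Ideal.mem_span_insert.mp hy₁
  obtain ⟨b, d, rfl⟩ := Ideal.mem_span_pair.mp hz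
  by_cases ha : IsUnit a
  · obtain ⟨au, rfl⟩ := ha
    refine ⟨↑au⁻¹ * d, ?_⟩
    have h1 : y₁ = ↑au * (c 0 + ↑au⁻¹ * d * c 2) + b * c 1 := by
      rw [hy, mul_add, ← mul_assoc, ← mul_assoc, Units.mul_inv, one_mul]; ring
    rw [h1, Ideal.span_pair_add_mul_right, Ideal.span_insert, Ideal.span_singleton_mul_left_unit au.isUnit,
      ← Ideal.span_insert]
  · -- `a ∈ 𝔪`: contradiction by the weight `w = (1, 2, 2)`
    exfalso
    have ham : a ∈ maximalIdeal S := (mem_maximalIdeal _).mpr ha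
    set w : Fin 3 → ℕ := ![1, 2, 2] with hw
    have hwpos : ∀ i, 0 < w i := by intro i; fin_cases i <;> simp [hw]
    have hc : ∀ i, c i ∈ maximalIdeal S := fun i => by
      rw [← hgen]
      fin_cases i
      · exact Ideal.subset_span (by simp)
      · exact Ideal.subset_span (by simp)
      · exact Ideal.subset_span (by simp)
    -- monomials of weight `≥ 2`
    have hmon : ∀ e : Fin 3 →₀ ℕ, 2 ≤ Finsupp.weight w e → monom3 c e ∈ weightedIdealW c w 2 :=
      fun e he => monomial_mem_weightedIdealW c w he
    have hc1 : c 1 ∈ weightedIdealW c w 2 := by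
      have h := hmon (Finsupp.single 1 1) (by simp [hw, Finsupp.weight_apply])
      simpa [monom3] using h
    have hc2 : c 2 ∈ weightedIdealW c w 2 := by
      have h := hmon (Finsupp.single 2 1) (by simp [hw, Finsupp.weight_apply])
      simpa [monom3] using h
    have hac0 : a * c 0 ∈ weightedIdealW c w 2 := by
      -- `a ∈ 𝔪 = (l, u, w)` so `a l ∈ (l², l u, l w)`
      rw [← hgen] at ham
      obtain ⟨a₀, z₀, hz₀, rfl⟩ := Ideal.mem_span_insert.mp ham
      obtain ⟨b₀, d₀, rfl⟩ := Ideal.mem_span_pair.mp hz₀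
      have h00 : c 0 * c 0 ∈ weightedIdealW c w 2 := by
        have h := hmon (Finsupp.single 0 2) (by simp [hw, Finsupp.weight_apply])
        simpa [monom3, pow_two] using h
      have : (a₀ * c 0 + (b₀ * c 1 + d₀ * c 2)) * c 0 =
          a₀ * (c 0 * c 0) + b₀ * c 0 * c 1 + d₀ * c 0 * c 2 := by ring
      rw [this]
      exact Ideal.add_mem _ (Ideal.add_mem _ (Ideal.mul_mem_left _ _ h00) (Ideal.mul_mem_left _ _ hc1))
        (Ideal.mul_mem_left _ _ hc2)
    have hy₁w : y₁ ∈ weightedIdealW c w 2 := by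
      rw [hy]
      exact Ideal.add_mem _ hac0 (Ideal.add_mem _ (Ideal.mul_mem_left _ _ hc1) (Ideal.mul_mem_left _ _ hc2))
    have hPw : Ideal.span ({y₁, c 1} : Set S) ≤ weightedIdealW c w 2 := by
      rw [Ideal.span_le, Set.insert_subset_iff, Set.singleton_subset_iff]
      exact ⟨hy₁w, hc1⟩
    have hJw : J ≤ weightedIdealW c w (μ + 1) :=
      calc J ≤ Ideal.span ({y₁, c 1} : Set S) ^ μ := hJP
        _ ≤ weightedIdealW c w 2 ^ μ := Ideal.pow_right_mono hPw μ
        _ ≤ weightedIdealW c w (μ * 2) := pow_weightedIdealW_le c w 2 μ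
        _ ≤ weightedIdealW c w (μ + 1) := weightedIdealW_antitone c w (by omega)
    -- a monic element `g ≡ f l^μ`
    obtain ⟨g, hgJ, hg⟩ := SetLike.not_le_iff_exists.mp hJne
    obtain ⟨f, hgf⟩ := exists_sub_mul_pow_mem_of_forall_initialForms c hgen hdim hJμ had hgJ
    have hfu : IsUnit f := by
      by_contra hf
      apply hg
      have hfm : f ∈ maximalIdeal S := (mem_maximalIdeal _).mpr hf
      have : f * c 0 ^ μ ∈ maximalIdeal S ^ (μ + 1) := by
        rw [pow_succ']; exact Ideal.mul_mem_mul hfm (Ideal.pow_mem_pow (hc 0) μ)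
      simpa using Ideal.add_mem _ hgf this
    have hfl : f * c 0 ^ μ ∈ weightedIdealW c w (μ + 1) := by
      have h1 : g - f * c 0 ^ μ ∈ weightedIdealW c w (μ + 1) :=
        pow_maximalIdeal_le_weightedIdealW c hgenr hwpos (μ + 1) hgf
      have : f * c 0 ^ μ = g - (g - f * c 0 ^ μ) := by ring
      rw [this]; exact Ideal.sub_mem _ (hJw hgJ) h1
    -- but `f l^μ = (C f · X₀^μ)(c)` has a unit coefficient in weight `μ`
    have hF : (C f * X (0 : Fin 3) ^ μ : MvPolynomial (Fin 3) S).IsWeightedHomogeneous w μ := by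
      have h := (isWeightedHomogeneous_C w f).mul (isWeightedHomogeneous_X S w (0 : Fin 3) |>.pow μ)
      simpa [hw] using h
    have hcoef : IsUnit ((C f * X (0 : Fin 3) ^ μ : MvPolynomial (Fin 3) S).coeff (Finsupp.single 0 μ)) := by
      rw [coeff_C_mul, coeff_X_pow, if_pos rfl, mul_one]; exact hfu
    refine eval_not_mem_of_isUnit_coeff c hgen hdim hwpos hF hcoef ?_
    rwa [map_mul, eval_C, map_pow, eval_X]

end Centre

end Literature.AlgebraicGeometry.Resolution

end
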